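import Mathlib.Algebra.MvPolynomial.Rename
import Mathlib.Algebra.MvPolynomial.Eval
import Literature.NumberTheory.Automorphic.HarishChandraGL
import HarnessLib

/-!
# Harish-Chandra parameters of the complex-conjugate module

Topic `NumberTheory/Automorphic`, namespace `Literature.NumberTheory.Automorphic`. Let `𝕜 = ℝ` or
`ℂ`, `𝔤 = 𝔤𝔩ₙ(𝕜)` as a REAL Lie algebra, and let `(V, ρ)` be a `𝔤`-module on a complex vector
space. Its **complex conjugate** `(V̄, ρ)` is the same real representation on the conjugate
complex structure `c ·̄ v = c̄ · v`; more generally a conjugate-linear bijection `e : V → V'` with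
`ρ' X (e v) = e (ρ X v)` exhibits `(V', ρ')` as the conjugate of `(V, ρ)` — the situation of the
complex conjugate `π̄ = {φ̄}` of an automorphic representation `π`, on which the real Lie algebra
acts through `X φ̄ = \overline{X φ}` (Clozel 1990, §3.1: `^cπ`). This file computes the
Harish-Chandra parameter of the conjugate (accepted `HasHCParameter` of `HarishChandraGL`):

* if `(V, ρ)` has infinitesimal character `θ`, the conjugate has infinitesimal character
  `z ↦ \overline{θ(z)}` (`HasCentralCharacter.of_conjSemilinear`);
* **`HasHCParameter.of_conjSemilinear`**: if `(V, ρ)` has Harish-Chandra parameter `χ`, the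
  conjugate has parameter `χ̄(τ) = \overline{χ(c ∘ τ)}` — conjugate the entries AND compose the
  index `τ : 𝕜 →ₐ[ℝ] ℂ` with complex conjugation `c` (for `𝕜 = ℂ` this swaps the two copies
  `id`, `conj` of `𝔤𝔩ₙ(ℂ)` in `𝔤_ℂ`; for `𝕜 = ℝ` it does nothing). On Langlands parameters
  restricted to `ℂˣ`: the character `z ↦ z^a z̄^b` becomes `z ↦ \overline{z^a z̄^b} = z^{b̄} z̄^{ā}`
  (Clozel 1990, §3.3; Knapp 2002, Thm. 5.44).

The proof transports the highest-weight normalisation of a Harish-Chandra homomorphism `γ`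
(hypothesis structure `HarishChandraHomGL`) through conjugate modules: the **conjugate
Harish-Chandra homomorphism** `γ.conj`, `z ↦ \overline{γ(z)} ∘ (relabel τ ↦ c ∘ τ)`
(`HarishChandraHomGL.conj`), is again a Harish-Chandra homomorphism — a highest weight vector of
weight `λ` in `V` is a highest weight vector of weight `λ̄(τ) = \overline{λ(c ∘ τ)}` in `V̄`
(`IsHighestWeightVector.conjVec`) — so the defining identity `θ = ev_χ ∘ γ'` for ALL `γ'` may be
applied to `γ.conj`. (By `harishChandraHomGL_unique` this shows in particular that `γ` is real:
`γ.conj = γ`.) Ingredients: the conjugate complex structure `ConjVec V` (`Module.compHom` along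
`starRingEnd ℂ`), and the real algebra homomorphism `End_ℂ(V) → End_ℂ(V')`, `T ↦ e T e⁻¹`, of a
conjugate-linear bijection (`semilinearConjAlgHom`; Mathlib's `LinearEquiv.conjAlgEquiv` is the
linear case). Everything is proved; no named facts.

## References

* A. W. Knapp, *Lie Groups Beyond an Introduction*, 2nd ed. (2002), §V.5, Thm. 5.44 [Knapp2002].
* L. Clozel, *Motifs et formes automorphes*, in Automorphic forms, Shimura varieties, and
  L-functions I (1990), §3.1, §3.3 [Clozel1990].
-/

-- Mathlib idiom (Mathlib/Algebra/Lie/OfAssociative.lean); the commutator Lie ring on `𝔤𝔩ₙ(𝕜)`, `End V`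
attribute [local instance 100] LieRing.ofAssociativeRing

noncomputable section

open scoped Matrix

namespace Literature.NumberTheory.Automorphic

open UniversalEnvelopingAlgebra MvPolynomial

/-! ### Conjugate-linear bijections conjugate complex-linear endomorphisms -/

section Semilinear

variable {V V' : Type*} [AddCommGroup V] [Module ℂ V] [AddCommGroup V'] [Module ℂ V']

/-- **`T ↦ e T e⁻¹` for a conjugate-linear bijection `e : V → V'`**: a REAL algebra homomorphism
`End_ℂ(V) →ₐ[ℝ] End_ℂ(V')` (it is conjugate-linear over `ℂ`; `e (c e⁻¹ v) = c̄ v`). The linear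
analogue is Mathlib's `LinearEquiv.conjAlgEquiv`. [folklore] -/
def semilinearConjAlgHom (e : V ≃ₛₗ[starRingEnd ℂ] V') : Module.End ℂ V →ₐ[ℝ] Module.End ℂ V' where
  toFun T := ((e : V →ₛₗ[starRingEnd ℂ] V').comp T).comp (e.symm : V' →ₛₗ[starRingEnd ℂ] V)
  map_one' := by
    refine LinearMap.ext fun v ↦ ?_
    simp only [LinearMap.coe_comp, LinearEquiv.coe_coe, Function.comp_apply, Module.End.one_apply,
      LinearEquiv.apply_symm_apply]
  map_mul' S T := by
    refine LinearMap.ext fun v ↦ ?_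
    simp only [LinearMap.coe_comp, LinearEquiv.coe_coe, Function.comp_apply, Module.End.mul_apply,
      LinearEquiv.symm_apply_apply]
  map_zero' := by
    refine LinearMap.ext fun v ↦ ?_
    simp only [LinearMap.coe_comp, LinearEquiv.coe_coe, Function.comp_apply, LinearMap.zero_apply,
      map_zero]
  map_add' S T := by
    refine LinearMap.ext fun v ↦ ?_
    simp only [LinearMap.coe_comp, LinearEquiv.coe_coe, Function.comp_apply, LinearMap.add_apply,
      map_add]
  commutes' r := by
    refine LinearMap.ext fun v ↦ ?_
    simp only [LinearMap.coe_comp, LinearEquiv.coe_coe, Function.comp_apply,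
      Module.algebraMap_end_apply]
    rw [RCLike.real_smul_eq_coe_smul (K := ℂ) r (e.symm v), LinearEquiv.map_smulₛₗ,
      RCLike.conj_ofReal, LinearEquiv.apply_symm_apply, ← RCLike.real_smul_eq_coe_smul (K := ℂ)]

/-- Unfolding: `semilinearConjAlgHom e T v' = e (T (e⁻¹ v'))`. [folklore] -/
@[simp]
theorem semilinearConjAlgHom_apply (e : V ≃ₛₗ[starRingEnd ℂ] V') (T : Module.End ℂ V) (v' : V') :
    semilinearConjAlgHom e T v' = e (T (e.symm v')) :=
  rfl

variable {L : Type*} [LieRing L] [LieAlgebra ℝ L]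

/-- **The infinitesimal character of a conjugate module is the conjugate character.** If
`ρ' X (e v) = e (ρ X v)` for a conjugate-linear bijection `e`, and `Z(L)` acts on `(V, ρ)` through
`θ`, then it acts on `(V', ρ')` through `z ↦ \overline{θ z}` (`lift ρ' = (e · e⁻¹) ∘ lift ρ`).
Knapp 2002, §V.5. [folklore] -/
theorem HasCentralCharacter.of_conjSemilinear (e : V ≃ₛₗ[starRingEnd ℂ] V')
    {ρ : L →ₗ⁅ℝ⁆ Module.End ℂ V} {ρ' : L →ₗ⁅ℝ⁆ Module.End ℂ V'}
    (he : ∀ (X : L) (v : V), ρ' X (e v) = e (ρ X v))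
    {θ : Subalgebra.center ℝ (UniversalEnvelopingAlgebra ℝ L) →ₐ[ℝ] ℂ}
    (hθ : HasCentralCharacter ρ θ) :
    HasCentralCharacter ρ' (Complex.conjAe.toAlgHom.comp θ) := by
  intro z
  have hlift : lift ℝ ρ' = (semilinearConjAlgHom e).comp (lift ℝ ρ) := by
    apply UniversalEnvelopingAlgebra.hom_ext
    refine LieHom.ext fun X ↦ ?_
    simp only [LieHom.coe_comp, Function.comp_apply, AlgHom.coe_toLieHom, AlgHom.coe_comp]
    rw [lift_ι_apply, lift_ι_apply]
    refine LinearMap.ext fun v' ↦ ?_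
    rw [semilinearConjAlgHom_apply, ← he, LinearEquiv.apply_symm_apply]
  rw [hlift, AlgHom.comp_apply, hθ z]
  refine LinearMap.ext fun v' ↦ ?_
  rw [semilinearConjAlgHom_apply, Module.algebraMap_end_apply, Module.algebraMap_end_apply,
    LinearEquiv.map_smulₛₗ, LinearEquiv.apply_symm_apply]
  rfl

end Semilinear

/-! ### The conjugate complex structure -/

/-- The **complex-conjugate vector space** `V̄`: the additive group `V` with the scalar
multiplication `c ·̄ v = c̄ · v` (Mathlib `Module.compHom` along `starRingEnd ℂ`). A real Lie
algebra representation on `V` by `ℂ`-linear maps is again one on `V̄`. [folklore] -/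
def ConjVec (V : Type*) : Type _ := V

namespace ConjVec

variable {V : Type*} [AddCommGroup V]

/-- `V̄` has the additive group structure of `V` (a fresh type synonym, so no Mathlib instance
is overridden). [folklore] -/
instance : AddCommGroup (ConjVec V) := inferInstanceAs (AddCommGroup V)

variable [Module ℂ V]

/-- The conjugate complex structure on `V̄`: `c ·̄ v = c̄ · v` (Mathlib `Module.compHom` along
`starRingEnd ℂ`; on the fresh synonym `ConjVec V` only). [folklore] -/
instance : Module ℂ (ConjVec V) := Module.compHom V (starRingEnd ℂ)

/-- The identity `V → V̄` as a conjugate-linear bijection. [folklore] -/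
def toConj : V ≃ₛₗ[starRingEnd ℂ] ConjVec V where
  toFun := id
  invFun := id
  map_add' _ _ := rfl
  map_smul' c v := by
    change c • v = starRingEnd ℂ (starRingEnd ℂ c) • v
    rw [starRingEnd_self_apply]
  left_inv _ := rfl
  right_inv _ := rfl

/-- `c ·̄ (toConj v) = toConj (c̄ · v)`. [folklore] -/
theorem smul_toConj (c : ℂ) (v : V) : c • toConj v = toConj (starRingEnd ℂ c • v) :=
  rfl

end ConjVec

/-! ### Conjugating the index `τ : 𝕜 →ₐ[ℝ] ℂ` and the Harish-Chandra variables -/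

section Index

variable {𝕜 : Type*} [RCLike 𝕜] {n : ℕ}

/-- Composition of a real-algebra embedding `τ : 𝕜 → ℂ` with complex conjugation (for `𝕜 = ℂ`:
`id ↔ conj`; for `𝕜 = ℝ`: the identity). [folklore] -/
def conjIdx (τ : 𝕜 →ₐ[ℝ] ℂ) : 𝕜 →ₐ[ℝ] ℂ :=
  Complex.conjAe.toAlgHom.comp τ

/-- `conjIdx τ x = \overline{τ x}`. [folklore] -/
@[simp]
theorem conjIdx_apply (τ : 𝕜 →ₐ[ℝ] ℂ) (x : 𝕜) : conjIdx τ x = starRingEnd ℂ (τ x) :=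
  rfl

/-- `conjIdx` is an involution. [folklore] -/
@[simp]
theorem conjIdx_conjIdx (τ : 𝕜 →ₐ[ℝ] ℂ) : conjIdx (conjIdx τ) = τ :=
  AlgHom.ext fun x ↦ by simp only [conjIdx_apply, starRingEnd_self_apply]

/-- `conjIdx` as a permutation of the (one or two) embeddings `𝕜 →ₐ[ℝ] ℂ`. [folklore] -/
def conjIdxEquiv : (𝕜 →ₐ[ℝ] ℂ) ≃ (𝕜 →ₐ[ℝ] ℂ) where
  toFun := conjIdx
  invFun := conjIdx
  left_inv := conjIdx_conjIdx
  right_inv := conjIdx_conjIdx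

/-- `conjIdxEquiv τ = conjIdx τ`. [folklore] -/
@[simp]
theorem conjIdxEquiv_apply (τ : 𝕜 →ₐ[ℝ] ℂ) : conjIdxEquiv τ = conjIdx τ :=
  rfl

variable (𝕜 n) in
/-- The relabelling `(τ, i) ↦ (c ∘ τ, i)` of the Harish-Chandra variables `x_{τ,i}` (an
involution). [folklore] -/
def conjVarEquiv : ((𝕜 →ₐ[ℝ] ℂ) × Fin n) ≃ ((𝕜 →ₐ[ℝ] ℂ) × Fin n) :=
  Equiv.prodCongr conjIdxEquiv (Equiv.refl (Fin n))

/-- `conjVarEquiv (τ, i) = (conjIdx τ, i)`. [folklore] -/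
@[simp]
theorem conjVarEquiv_apply (p : (𝕜 →ₐ[ℝ] ℂ) × Fin n) : conjVarEquiv 𝕜 n p = (conjIdx p.1, p.2) :=
  rfl

/-- The **conjugate weight** `λ̄(τ, i) = \overline{λ(c ∘ τ, i)}`. [folklore] -/
def conjWeight (l : ArchWeightGL 𝕜 n) : ArchWeightGL 𝕜 n :=
  fun τ i ↦ starRingEnd ℂ (l (conjIdx τ) i)

/-- `conjWeight l τ i = \overline{l (c ∘ τ) i}`. [folklore] -/
@[simp]
theorem conjWeight_apply (l : ArchWeightGL 𝕜 n) (τ : 𝕜 →ₐ[ℝ] ℂ) (i : Fin n) :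
    conjWeight l τ i = starRingEnd ℂ (l (conjIdx τ) i) :=
  rfl

/-- **The value of the conjugate weight is the conjugate value**:
`λ̄(diag h) = \overline{λ(diag h)}` (reindex `τ ↦ c ∘ τ`). [folklore] -/
theorem weightFun_conjWeight (l : ArchWeightGL 𝕜 n) (h : Fin n → 𝕜) :
    weightFun (conjWeight l) h = starRingEnd ℂ (weightFun l h) := by
  simp only [weightFun, map_sum, map_mul, conjWeight_apply]
  rw [← (conjIdxEquiv (𝕜 := 𝕜)).sum_comp]
  refine Finset.sum_congr rfl fun τ _ ↦ Finset.sum_congr rfl fun i _ ↦ ?_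
  rw [conjIdxEquiv_apply, conjIdx_conjIdx, conjIdx_apply]

/-- `ρ` is real: `\overline{ρ_i} = ρ_i`. [folklore] -/
theorem starRingEnd_rhoGL (i : Fin n) : starRingEnd ℂ (rhoGL n i) = rhoGL n i := by
  simp only [rhoGL, map_sub, map_div₀, map_natCast, map_one, map_ofNat]

/-- The **conjugate of a Harish-Chandra polynomial**: conjugate the coefficients and relabel the
variables by `(τ, i) ↦ (c ∘ τ, i)`, as a real algebra endomorphism of `ℂ[x_{τ,i}]`. [folklore] -/
def conjPolyHom (𝕜 : Type*) [RCLike 𝕜] (n : ℕ) :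
    MvPolynomial ((𝕜 →ₐ[ℝ] ℂ) × Fin n) ℂ →ₐ[ℝ] MvPolynomial ((𝕜 →ₐ[ℝ] ℂ) × Fin n) ℂ :=
  (MvPolynomial.mapAlgHom Complex.conjAe.toAlgHom).comp
    ((MvPolynomial.rename (conjVarEquiv 𝕜 n)).restrictScalars ℝ)

/-- Unfolding: `conjPolyHom p = map conj (rename conjVarEquiv p)`. [folklore] -/
theorem conjPolyHom_apply (p : MvPolynomial ((𝕜 →ₐ[ℝ] ℂ) × Fin n) ℂ) :
    conjPolyHom 𝕜 n p = MvPolynomial.map (starRingEnd ℂ) (MvPolynomial.rename (conjVarEquiv 𝕜 n) p) :=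
  rfl

/-- **Evaluating a conjugate polynomial**: `\bar p(x) = \overline{p(\overline{x ∘ r})}` with `r` the
relabelling, i.e. `aeval g (conjPolyHom p) = \overline{aeval (x ↦ \overline{g (r x)}) p}`. [folklore] -/
theorem aeval_conjPolyHom (g : (𝕜 →ₐ[ℝ] ℂ) × Fin n → ℂ) (p : MvPolynomial ((𝕜 →ₐ[ℝ] ℂ) × Fin n) ℂ) :
    aeval g (conjPolyHom 𝕜 n p) =
      starRingEnd ℂ (aeval (fun x ↦ starRingEnd ℂ (g (conjVarEquiv 𝕜 n x))) p) := by
  rw [conjPolyHom_apply, aeval_eq_eval₂Hom, aeval_eq_eval₂Hom, coe_eval₂Hom, coe_eval₂Hom,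
    eval₂_map, eval₂_rename, eval₂_comp_left]
  congr 1
  funext x
  simp only [Function.comp_apply, starRingEnd_self_apply]

end Index

/-! ### The conjugate representation and its highest weight vectors -/

namespace ConjVec

variable {V : Type*} [AddCommGroup V] [Module ℂ V] {L : Type*} [LieRing L] [LieAlgebra ℝ L]

/-- The **conjugate representation** `ρ̄` of a real Lie algebra on `V̄`: the same operators,
`ρ̄ X = toConj ∘ ρ X ∘ toConj⁻¹` (complex-linear for the conjugate structure). Knapp 2002, §V.5;
Clozel 1990, §3.1. [folklore] -/
def conjRep (ρ : L →ₗ⁅ℝ⁆ Module.End ℂ V) : L →ₗ⁅ℝ⁆ Module.End ℂ (ConjVec V) :=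
  (semilinearConjAlgHom (toConj (V := V))).toLieHom.comp ρ

/-- `ρ̄ X (toConj v) = toConj (ρ X v)`. [folklore] -/
@[simp]
theorem conjRep_apply_toConj (ρ : L →ₗ⁅ℝ⁆ Module.End ℂ V) (X : L) (v : V) :
    conjRep ρ X (toConj v) = toConj (ρ X v) :=
  rfl

/-- `lift ρ̄ = (toConj · toConj⁻¹) ∘ lift ρ` on the enveloping algebra. [folklore] -/
theorem lift_conjRep (ρ : L →ₗ⁅ℝ⁆ Module.End ℂ V) :
    lift ℝ (conjRep ρ) = (semilinearConjAlgHom (toConj (V := V))).comp (lift ℝ ρ) := by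
  apply UniversalEnvelopingAlgebra.hom_ext
  refine LieHom.ext fun X ↦ ?_
  simp only [LieHom.coe_comp, Function.comp_apply, AlgHom.coe_toLieHom, AlgHom.coe_comp]
  rw [lift_ι_apply, lift_ι_apply]
  rfl

variable {𝕜 : Type*} [RCLike 𝕜] {n : ℕ}

/-- **A highest weight vector of weight `λ` in `V` is a highest weight vector of weight `λ̄` in
`V̄`** (`𝔫 v = 0` is unchanged; `diag(h) v = λ(h) v = \overline{λ(h)} ·̄ v = λ̄(h) ·̄ v`).
Knapp 2002, §V.2–V.3. [folklore] -/
theorem isHighestWeightVector_conjRep {ρ : Matrix (Fin n) (Fin n) 𝕜 →ₗ⁅ℝ⁆ Module.End ℂ V}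
    {l : ArchWeightGL 𝕜 n} {v : V} (hv : IsHighestWeightVector ρ l v) :
    IsHighestWeightVector (conjRep ρ) (conjWeight l) (toConj v) := by
  refine ⟨hv.1, fun X hX ↦ ?_, fun h ↦ ?_⟩
  · rw [conjRep_apply_toConj, hv.2.1 X hX, map_zero]
  · rw [conjRep_apply_toConj, hv.2.2 h, weightFun_conjWeight, smul_toConj, starRingEnd_self_apply]

end ConjVec

/-! ### The conjugate Harish-Chandra homomorphism -/

section ConjHom

variable {𝕜 : Type*} [RCLike 𝕜] {n : ℕ}

/-- The relabelling `(τ, i) ↦ (c ∘ τ, i)` intertwines a `τ`-wise permutation `σ` with the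
`τ`-wise permutation `τ ↦ σ_{c ∘ τ}`. [folklore] -/
theorem prodCongrRight_comp_conjVarEquiv (σ : (𝕜 →ₐ[ℝ] ℂ) → Equiv.Perm (Fin n)) :
    (⇑(Equiv.prodCongrRight σ) ∘ ⇑(conjVarEquiv 𝕜 n) :
        (𝕜 →ₐ[ℝ] ℂ) × Fin n → (𝕜 →ₐ[ℝ] ℂ) × Fin n) =
      ⇑(conjVarEquiv 𝕜 n) ∘ ⇑(Equiv.prodCongrRight fun τ ↦ σ (conjIdx τ)) := by
  funext ⟨τ, i⟩
  rfl

/-- **The conjugate Harish-Chandra homomorphism** `γ̄(z) = \overline{γ(z)}(x ∘ r)` (conjugate the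
coefficients of `γ(z)` and relabel `x_{τ,i} ↦ x_{c∘τ,i}`): again a Harish-Chandra homomorphism —
its values are `τ`-wise symmetric, and it has the highest weight normalisation because `γ` has it
in the conjugate modules `V̄` (`ConjVec.isHighestWeightVector_conjRep`). By uniqueness
(`harishChandraHomGL_unique`) `γ̄ = γ`, i.e. the Harish-Chandra homomorphism is real; here only
the construction is needed. Knapp 2002, §V.5, Thm. 5.44. [cite: Knapp2002, §V.5 Thm. 5.44] -/
def HarishChandraHomGL.conj (γ : HarishChandraHomGL 𝕜 n) : HarishChandraHomGL 𝕜 n where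
  toAlgHom := (conjPolyHom 𝕜 n).comp γ.toAlgHom
  symmetric σ z := by
    change rename (Equiv.prodCongrRight σ) (conjPolyHom 𝕜 n (γ.toAlgHom z)) =
      conjPolyHom 𝕜 n (γ.toAlgHom z)
    conv_lhs =>
      rw [conjPolyHom_apply, map_rename, rename_rename, prodCongrRight_comp_conjVarEquiv σ,
        ← rename_rename, ← map_rename, γ.symmetric (fun τ ↦ σ (conjIdx τ)) z]
    rw [conjPolyHom_apply, map_rename]
  highestWeight V _ _ ρ l v hv z := by
    have h := γ.highestWeight (ConjVec V) (ConjVec.conjRep ρ) (conjWeight l) (ConjVec.toConj v)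
      (ConjVec.isHighestWeightVector_conjRep hv) z
    rw [ConjVec.lift_conjRep, AlgHom.comp_apply, semilinearConjAlgHom_apply,
      LinearEquiv.symm_apply_apply, ConjVec.smul_toConj] at h
    have hf : (fun x : (𝕜 →ₐ[ℝ] ℂ) × Fin n ↦ starRingEnd ℂ
        (l (conjVarEquiv 𝕜 n x).1 (conjVarEquiv 𝕜 n x).2 + rhoGL n (conjVarEquiv 𝕜 n x).2)) =
        fun p ↦ conjWeight l p.1 p.2 + rhoGL n p.2 := by
      funext x
      rw [conjVarEquiv_apply, map_add, starRingEnd_rhoGL, conjWeight_apply]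
    rw [ConjVec.toConj.injective h, AlgHom.comp_apply, aeval_conjPolyHom, hf]

/-- Unfolding: `γ.conj z = conjPolyHom (γ z)`. [folklore] -/
theorem HarishChandraHomGL.conj_toAlgHom_apply (γ : HarishChandraHomGL 𝕜 n)
    (z : Subalgebra.center ℝ (UniversalEnvelopingAlgebra ℝ (Matrix (Fin n) (Fin n) 𝕜))) :
    γ.conj.toAlgHom z = conjPolyHom 𝕜 n (γ.toAlgHom z) :=
  rfl

/-! ### Harish-Chandra parameters of conjugate modules -/

variable {V V' : Type*} [AddCommGroup V] [Module ℂ V] [AddCommGroup V'] [Module ℂ V']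

/-- An enumeration `l'` of `χ̄(τ) = \overline{χ(c ∘ τ)}` gives the enumeration `conjWeight l'`
of `χ`. [folklore] -/
theorem univ_val_map_conjWeight {χ : (𝕜 →ₐ[ℝ] ℂ) → Multiset ℂ} {l' : (𝕜 →ₐ[ℝ] ℂ) → Fin n → ℂ}
    (hl' : ∀ τ, Finset.univ.val.map (l' τ) = (χ (conjIdx τ)).map (starRingEnd ℂ)) (τ : 𝕜 →ₐ[ℝ] ℂ) :
    Finset.univ.val.map (conjWeight l' τ) = χ τ := by
  have h1 := congrArg (Multiset.map (starRingEnd ℂ)) (hl' (conjIdx τ))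
  rw [conjIdx_conjIdx, Multiset.map_map, Multiset.map_map] at h1
  have hcc : (starRingEnd ℂ ∘ starRingEnd ℂ : ℂ → ℂ) = id := funext starRingEnd_self_apply
  rw [hcc, Multiset.map_id] at h1
  exact h1

/-- **The Harish-Chandra parameter of a conjugate module.** Let `e : V → V'` be a conjugate-linear
bijection intertwining the real Lie algebra representations `ρ` on `V` and `ρ'` on `V'` of
`𝔤𝔩ₙ(𝕜)` (`ρ' X (e v) = e (ρ X v)`; e.g. `V' = V̄`, or `φ ↦ φ̄` on automorphic forms). If `(V, ρ)`
has Harish-Chandra parameter `χ`, then `(V', ρ')` has Harish-Chandra parameter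
`χ̄(τ) = \overline{χ(c ∘ τ)}`: its infinitesimal character is `\overline{θ}`
(`HasCentralCharacter.of_conjSemilinear`), and `\overline{θ} = ev_{χ̄} ∘ γ` for every
Harish-Chandra homomorphism `γ` because `θ = ev_χ ∘ γ̄` for the conjugate homomorphism `γ̄`
(`HarishChandraHomGL.conj`). On Langlands parameters: `z^a z̄^b ↦ z^{b̄} z̄^{ā}`.
Knapp 2002, Thm. 5.44; Clozel 1990, §3.1, §3.3. [cite: Knapp2002, §V.5 Thm. 5.44] -/
theorem HasHCParameter.of_conjSemilinear (e : V ≃ₛₗ[starRingEnd ℂ] V')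
    {ρ : Matrix (Fin n) (Fin n) 𝕜 →ₗ⁅ℝ⁆ Module.End ℂ V}
    {ρ' : Matrix (Fin n) (Fin n) 𝕜 →ₗ⁅ℝ⁆ Module.End ℂ V'}
    (he : ∀ (X : Matrix (Fin n) (Fin n) 𝕜) (v : V), ρ' X (e v) = e (ρ X v))
    {χ : (𝕜 →ₐ[ℝ] ℂ) → Multiset ℂ} (hχ : HasHCParameter ρ χ) :
    HasHCParameter ρ' fun τ ↦ (χ (conjIdx τ)).map (starRingEnd ℂ) := by
  obtain ⟨hcard, θ, hθ, hθχ⟩ := hχ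
  refine ⟨fun τ ↦ by rw [Multiset.card_map, hcard], Complex.conjAe.toAlgHom.comp θ,
    hθ.of_conjSemilinear e he, fun γ l' hl' z ↦ ?_⟩
  have key := hθχ γ.conj (conjWeight l') (univ_val_map_conjWeight hl') z
  have hf : (fun x : (𝕜 →ₐ[ℝ] ℂ) × Fin n ↦
      starRingEnd ℂ (conjWeight l' (conjVarEquiv 𝕜 n x).1 (conjVarEquiv 𝕜 n x).2)) =
        fun p ↦ l' p.1 p.2 := by
    funext x
    rw [conjVarEquiv_apply, conjWeight_apply, conjIdx_conjIdx, starRingEnd_self_apply]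
  change starRingEnd ℂ (θ z) = _
  rw [key, HarishChandraHomGL.conj_toAlgHom_apply, aeval_conjPolyHom, starRingEnd_self_apply, hf]

end ConjHom

end Literature.NumberTheory.Automorphic
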